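/-
Origin: expansion seat `planner-pub-hodgecm-pv01-g5-0`, handover #3 2026-08-18T07:31:54Z (`HOME/pub-hodgecm-pv01-g5/lean/Pv01g5/EndStateBinderSep.lean`, md5 4616460c, 265 lines);
landed by the gen-7 packager in gate run 26 as `HodgeCM/PerL34/EndStateBinderSep.lean` (import ^import Pv[0-9]+g[0-9]+\.→import HodgeCM.PerL34. ×1).
-/
/-
# Two single-binder separations of the PerL end state: the `(34)` Qaut bridge (`hQ`) and the
# [Liu21] interface (`hAlb`) are each independent of the rest of the headline

Origin: DAG-node prover seat `planner-pub-hodgecm-pv01-g5-0` (gen 5 of `pub-hodgecm-pv01`), 2026-08-18, handover #3,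
for gate run 26.  NEW additive leaf under `HodgeCM/PerL34/`; imports only landed modules of the package and
`Pv01g5.EndStateShadow` (handover #2 of the same seat; import prefix `Pv01g5.` ↦ `HodgeCM.PerL34.` on landing).
Mathlib + the package only; `#print axioms` ⊆ {propext, Classical.choice, Quot.sound}; no placeholders.

ABSOLUTE RULE respected: nothing here is a cited fact and nothing is minted.  The statements are RELATIVE consistency /
independence results about the thirteen hypothesis binders of the package headline
`AssemblyRoutes.perL_of_openCharsWeilLeavesCRΔ` (bundled verbatim as `EndStateShadow.EndState T Pc`), obtained from
toy2's kernel theta-model modifications `ThetaModel.drop23` / `ThetaModel.conj02` (`Model/ThetaSeparation.lean`,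
Landherr-discharged forms in `Proofs/LandherrDischarge.lean`) by transporting the RECORD binders of the headline
(`SeesawBridge`, `QautBridge`, `ArchCDatum`, `WeilStepsInputCRΔ`, `Fact_thetaAlbanese`) along `T.withTheta Θ`.

What is proved (kernel-checked), for any universe `U`, theta model `T`, pointed cores `Pc`:

* `separating_qaut`:  `U ⊨ ModelAxioms ∧ EndState T Pc` ⟹ `(U, T.drop23)` satisfies the model axioms, PerL, and ALL
  binders of the end state EXCEPT `hQ` — and REFUTES `hQ` ("a Qaut bridge on the `(34)` side in every good context").
  So `hQ` (seam S5, `(34)` side; equivalently the leaf `N19g_core`, pv08 `S5ConservativeQaut.qautBridges_iff_core`)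
  is NOT a consequence of the other twelve binders and the 28 facts (relative to their joint consistency), and is not
  NECESSARY for PerL.
* `separating_alb`:  likewise `(U, T.conj02)` satisfies the model axioms, PerL and all binders EXCEPT `hAlb`, and
  REFUTES `hAlb` (`Fact_thetaAlbanese`, the [Liu21] interface of seam S6; equivalently `Open_thetaSub`, pv12
  `S6Strength.thetaAlbanese_iff_open`).
* `exists_model_…` corollaries in the `∃ U T Pc` form, under the hypothesis that the end state has a model at all.

Mechanism (toy2, by name): `drop23` deletes the theta one-forms of types `Ψ₂, Ψ₃`, which kills `Open_thetaReal34`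
(`drop23_not_thetaReal34''`: some generator of `S₃₄` is non-zero, by Prop 4.3's wedge, `emb_ne_zero`, Thm 3.7) while
every other binder reads only types `Ψ₀, Ψ₁`, the cores, the torus data, `emb`, `cover`; `conj02` ADDS the complex
conjugates of the type-`Ψ₀` forms to type `Ψ₂`, which kills `Open_thetaSub` (`conj02_not_thetaSub''`: Hodge symmetry)
and hence `hAlb` (`N12a_thetaSub_of_split`), while the `(34)` Qaut bridge survives because its only theta-dependent
field `wedge_mem` is MONOTONE in the theta forms.

Together with handover #2 (`EndStateShadow`: `{h07, h09b}` jointly independent AND jointly load-bearing for PerL) and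
pv01-g4's `EndStateSeparation` (`hW` independent of the other dictionary leaves, Hecke saturation A6 kept), this is the
referee's "independent of" column (REFEREE.md r19 P5) for four of the thirteen binders.  NOT claimed: consistency of
the end state; anything about the intended model; independence of `hbr`, `A12/A34`, `hch`, `h09a`, `h12b`, `hM38`.
-/
import Summits.HodgeConjecture.HodgeCM.PerL34.EndStateShadow

set_option autoImplicit false

noncomputable section

open HodgeCM.Prior.Perl34File HodgeCM.Prior.Perl34File.Perl34 HodgeCM.PerL34.ArchC

namespace HodgeCM

namespace PerL34

namespace EndStateBinderSep

open Universe Universe.ThetaModel AssemblyRoutes EndStateShadow CharSpansFinal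

variable {U : Universe}

/-! ## 1. Transport of the record binders along `T.withTheta Θ` -/

section withTheta

variable (T : U.ThetaModel)
variable (Θ : ∀ {L : CMField} {ι₁ : L →+* ℂ} (V : HermSpace3 L ι₁), SeesawCtx L → Fin 4 →
    ∀ Γ : Level V, Set (U.CohC (U.pms L ι₁ V Γ) 1))

/-- The wedge-set of types `(k, l)` is monotone in the theta forms of types `k`, `l`. -/
theorem wedgeSet_subset_withTheta {L : CMField} {ι₁ : L →+* ℂ} (V : HermSpace3 L ι₁) (c : SeesawCtx L)
    (k l : Fin 4) (hk : ∀ Γ, T.Theta V c k Γ ⊆ Θ V c k Γ) (hl : ∀ Γ, T.Theta V c l Γ ⊆ Θ V c l Γ) :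
    T.wedgeSet V c k l ⊆ (T.withTheta Θ).wedgeSet V c k l := by
  rintro x ⟨Γ, ω, hω, ω', hω', rfl⟩
  exact ⟨Γ, ω, hk Γ hω, ω', hl Γ hω', rfl⟩

/-- A seesaw bridge on sides `(k, l)` survives SHRINKING the theta forms of types `k`, `l` (its only theta-dependent
field `Λ_wedge` is universally quantified over them). -/
def seesawBridgeWithTheta {L : CMField} {ι₁ : L →+* ℂ} {V : HermSpace3 L ι₁} {c : SeesawCtx L} {k l : Fin 4}
    (hk : ∀ Γ, Θ V c k Γ ⊆ T.Theta V c k Γ) (hl : ∀ Γ, Θ V c l Γ ⊆ T.Theta V c l Γ) {D}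
    (B : SeesawDictionary.SeesawBridge T V c D k l) : SeesawDictionary.SeesawBridge (T.withTheta Θ) V c D k l :=
  { B with Λ_wedge := fun Γ ω hω ω' hω' => B.Λ_wedge Γ ω (hk Γ hω) ω' (hl Γ hω') }

/-- A Qaut bridge on sides `(k, l)` survives ENLARGING the theta forms of types `k`, `l` (its only theta-dependent
field `wedge_mem` concludes membership in the wedge-set). -/
def qautBridgeWithTheta {L : CMField} {ι₁ : L →+* ℂ} {V : HermSpace3 L ι₁} {c : SeesawCtx L} {k l : Fin 4}
    (hk : ∀ Γ, T.Theta V c k Γ ⊆ Θ V c k Γ) (hl : ∀ Γ, T.Theta V c l Γ ⊆ Θ V c l Γ) {D}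
    (B : QautDictionary.QautBridge T V c D k l) : QautDictionary.QautBridge (T.withTheta Θ) V c D k l :=
  { B with wedge_mem := fun χ hχ u hu v hv =>
      wedgeSet_subset_withTheta T Θ V c k l hk hl (B.wedge_mem χ hχ u hu v hv) }

/-- The character-line span model and its Weil package do not mention the theta forms. -/
def charLineSpansCRWithTheta {L : CMField} {ι₁ : L →+* ℂ} {V : HermSpace3 L ι₁} {c : SeesawCtx L}
    (M : CharSpansCR.CharLineSpansCR T V c) : CharSpansCR.CharLineSpansCR (T.withTheta Θ) V c :=
  { M with }

/-- (as above) -/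
def weilPackageCRWithTheta {L : CMField} {ι₁ : L →+* ℂ} {V : HermSpace3 L ι₁} {c : SeesawCtx L}
    {M : CharSpansCR.CharLineSpansCR T V c} (P : CharSpansCR.WeilPackageCR T M) :
    CharSpansCR.WeilPackageCR (T.withTheta Θ) (charLineSpansCRWithTheta T Θ M) :=
  { P with }

/-- `WeilStepsInputCRΔ` survives ENLARGING the theta forms of types `Ψ₀`, `Ψ₁` (its theta-dependent conjuncts
`Dict_thetaClass₀/₁` conclude membership in them). -/
theorem weilStepsInputCRΔ_withTheta
    (h0 : ∀ {L : CMField} {ι₁ : L →+* ℂ} (V : HermSpace3 L ι₁) (c : SeesawCtx L) (Γ : Level V),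
      T.Theta V c 0 Γ ⊆ Θ V c 0 Γ)
    (h1 : ∀ {L : CMField} {ι₁ : L →+* ℂ} (V : HermSpace3 L ι₁) (c : SeesawCtx L) (Γ : Level V),
      T.Theta V c 1 Γ ⊆ Θ V c 1 Γ)
    (hW : WeilStepsInputCRΔ T) : WeilStepsInputCRΔ (T.withTheta Θ) := by
  intro L ι₁ V c hc
  obtain ⟨M, ⟨P⟩, ⟨Tfr, hT, ψ, hΓ⟩, hd₀, hd₁, hcup⟩ := hW V c ((T.withTheta_goodCtx_iff Θ ι₁ c).mp hc)
  exact ⟨charLineSpansCRWithTheta T Θ M, ⟨weilPackageCRWithTheta T Θ P⟩, ⟨Tfr, hT, ψ, hΓ⟩,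
    fun d hd u hu Γ hΓ => h0 V c Γ (hd₀ d hd u hu Γ hΓ), fun d hd u hu Γ hΓ => h1 V c Γ (hd₁ d hd u hu Γ hΓ), hcup⟩

/-- `Fact_thetaAlbanese` survives SHRINKING the theta forms (all types). -/
theorem thetaAlbanese_withTheta
    (h : ∀ {L : CMField} {ι₁ : L →+* ℂ} (V : HermSpace3 L ι₁) (c : SeesawCtx L) (i : Fin 4) (Γ : Level V),
      Θ V c i Γ ⊆ T.Theta V c i Γ)
    (hA : T.Fact_thetaAlbanese) : (T.withTheta Θ).Fact_thetaAlbanese := by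
  intro L ι₁ V c hc i Γ
  obtain ⟨M, k, σ', hk, hsub⟩ := hA V c ((T.withTheta_goodCtx_iff Θ ι₁ c).mp hc) i Γ
  exact ⟨M, k, σ', hk, (h V c i Γ).trans hsub⟩

end withTheta

/-! ## 2. The end state without `hQ` and `hAlb` -/

/-- The `hQ` binder of the headline ("a Qaut bridge on the `(34)` side in every good context"), as a named Prop. -/
def QautBinder (T : U.ThetaModel) : Prop :=
  ∀ {L : CMField} {ι₁ : L →+* ℂ} (V : HermSpace3 L ι₁) (c : SeesawCtx L), T.GoodCtx ι₁ c →
    Nonempty (QautDictionary.QautBridge T V c (T.t34 V c) 2 3)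

variable (T : U.ThetaModel)

/-- The END STATE without its binders `hQ` and `hAlb` (the other eleven, verbatim). -/
structure EndStateSansQautAlb
    (Pc : ∀ {L : CMField} {ι₁ : L →+* ℂ} (V : HermSpace3 L ι₁) (c : SeesawCtx L),
      C4a.PointedCore (T.core V c)) : Prop where
  h07 : N07_hodgeRiemann20 U
  h09a : N09a_embCover T
  h09b : N09b_innerEmb T
  hM38 : U.Fact_cmInflation
  h12b : N12b_signRecipe T
  hbr : ∀ {L : CMField} {ι₁ : L →+* ℂ} (V : HermSpace3 L ι₁) (c : SeesawCtx L), T.GoodCtx ι₁ c →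
    Nonempty (SeesawDictionary.SeesawBridge T V c (T.t12 V c) 0 1)
  A12 : ∀ {L : CMField} {ι₁ : L →+* ℂ} (V : HermSpace3 L ι₁) (c : SeesawCtx L),
    T.GoodCtx ι₁ c → Nonempty (ArchCDatum (T.core V c) (T.t12 V c) (Pc V c))
  A34 : ∀ {L : CMField} {ι₁ : L →+* ℂ} (V : HermSpace3 L ι₁) (c : SeesawCtx L),
    T.GoodCtx ι₁ c → Nonempty (ArchCDatum (T.core V c) (T.t34 V c) (Pc V c))
  hch : T.Open_chars
  hW : CharSpansFinal.WeilStepsInputCRΔ T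

variable {T}
variable {Pc : ∀ {L : CMField} {ι₁ : L →+* ℂ} (V : HermSpace3 L ι₁) (c : SeesawCtx L),
  C4a.PointedCore (T.core V c)}

/-- (Ported verbatim from the HodgeCMPerL package; no docstring in the source.) -/
theorem endState_iff_sans : EndState T Pc ↔ EndStateSansQautAlb T Pc ∧ QautBinder T ∧ T.Fact_thetaAlbanese :=
  ⟨fun E => ⟨⟨E.h07, E.h09a, E.h09b, E.hM38, E.h12b, E.hbr, E.A12, E.A34, E.hch, E.hW⟩, E.hQ, E.hAlb⟩,
    fun ⟨E, hQ, hAlb⟩ => ⟨E.h07, E.h09a, E.h09b, E.hM38, hAlb, E.h12b, E.hbr, hQ, E.A12, E.A34, E.hch, E.hW⟩⟩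

/-- **Transport of the eleven** along a re-choice of theta forms that does not change types `Ψ₀`, `Ψ₁` (as sets). -/
theorem EndStateSansQautAlb.withTheta
    (Θ : ∀ {L : CMField} {ι₁ : L →+* ℂ} (V : HermSpace3 L ι₁), SeesawCtx L → Fin 4 →
      ∀ Γ : Level V, Set (U.CohC (U.pms L ι₁ V Γ) 1))
    (hle : ∀ {L : CMField} {ι₁ : L →+* ℂ} (V : HermSpace3 L ι₁) (c : SeesawCtx L) (i : Fin 4) (Γ : Level V),
      i = 0 ∨ i = 1 → Θ V c i Γ ⊆ T.Theta V c i Γ)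
    (hge : ∀ {L : CMField} {ι₁ : L →+* ℂ} (V : HermSpace3 L ι₁) (c : SeesawCtx L) (i : Fin 4) (Γ : Level V),
      i = 0 ∨ i = 1 → T.Theta V c i Γ ⊆ Θ V c i Γ)
    (E : EndStateSansQautAlb T Pc) : EndStateSansQautAlb (T.withTheta Θ) Pc where
  h07 := E.h07
  h09a := E.h09a
  h09b := E.h09b
  hM38 := E.hM38
  h12b := E.h12b
  hbr V c hc := by
    obtain ⟨B⟩ := E.hbr V c ((T.withTheta_goodCtx_iff Θ _ c).mp hc)
    exact ⟨seesawBridgeWithTheta T Θ (fun Γ => hle V c 0 Γ (Or.inl rfl)) (fun Γ => hle V c 1 Γ (Or.inr rfl)) B⟩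
  A12 V c hc := E.A12 V c ((T.withTheta_goodCtx_iff Θ _ c).mp hc)
  A34 V c hc := E.A34 V c ((T.withTheta_goodCtx_iff Θ _ c).mp hc)
  hch := (T.withTheta_chars_iff Θ).mpr E.hch
  hW := weilStepsInputCRΔ_withTheta T Θ (fun V c Γ => hge V c 0 Γ (Or.inl rfl))
    (fun V c Γ => hge V c 1 Γ (Or.inr rfl)) E.hW

/-- `QautBinder` along a re-choice of theta forms ENLARGING types `Ψ₂`, `Ψ₃`. -/
theorem qautBinder_withTheta
    (Θ : ∀ {L : CMField} {ι₁ : L →+* ℂ} (V : HermSpace3 L ι₁), SeesawCtx L → Fin 4 →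
      ∀ Γ : Level V, Set (U.CohC (U.pms L ι₁ V Γ) 1))
    (hge : ∀ {L : CMField} {ι₁ : L →+* ℂ} (V : HermSpace3 L ι₁) (c : SeesawCtx L) (i : Fin 4) (Γ : Level V),
      i = 2 ∨ i = 3 → T.Theta V c i Γ ⊆ Θ V c i Γ)
    (hQ : QautBinder T) : QautBinder (T.withTheta Θ) := by
  intro L ι₁ V c hc
  obtain ⟨B⟩ := hQ V c ((T.withTheta_goodCtx_iff Θ _ c).mp hc)
  exact ⟨qautBridgeWithTheta T Θ (fun Γ => hge V c 2 Γ (Or.inl rfl)) (fun Γ => hge V c 3 Γ (Or.inr rfl)) B⟩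

/-! ## 3. `hQ` is independent of the rest: `T.drop23` -/

/-- (Ported verbatim from the HodgeCMPerL package; no docstring in the source.) -/
theorem drop23_sans (E : EndStateSansQautAlb T Pc) : EndStateSansQautAlb T.drop23 Pc :=
  E.withTheta _ (fun _ _ _ _ _ _ hω => hω.1) (fun _ _ _ _ hi _ hω => ⟨hω, hi⟩)

/-- (Ported verbatim from the HodgeCMPerL package; no docstring in the source.) -/
theorem drop23_thetaAlbanese (h : T.Fact_thetaAlbanese) : T.drop23.Fact_thetaAlbanese :=
  thetaAlbanese_withTheta T _ (fun _ _ _ _ _ hω => hω.1) h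

/-- `(U, T.drop23)` REFUTES `hQ` as soon as `(U, T) ⊨ ModelAxioms ∧ EndState`: `hQ` gives `Open_thetaReal34`
(`N19g_genInWedgeSpan_of_bridges`), refuted by toy2's `drop23_not_thetaReal34''`. -/
theorem drop23_not_qautBinder (M : U.ModelAxioms) (E : EndState T Pc) : ¬ QautBinder T.drop23 :=
  fun hQ => T.drop23_not_thetaReal34'' M (E.inputs M) E.h07 (N19g_genInWedgeSpan_of_bridges T.drop23 hQ)

/-- **Separating model for `hQ` at headline level.** -/
theorem separating_qaut (M : U.ModelAxioms) (E : EndState T Pc) :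
    U.ModelAxioms ∧ U.PerL ∧ EndStateSansQautAlb T.drop23 Pc ∧ T.drop23.Fact_thetaAlbanese ∧
      ¬ QautBinder T.drop23 :=
  ⟨M, E.perL M, drop23_sans (endState_iff_sans.mp E).1, drop23_thetaAlbanese E.hAlb, drop23_not_qautBinder M E⟩

/-! ## 4. `hAlb` is independent of the rest: `T.conj02` -/

/-- (Ported verbatim from the HodgeCMPerL package; no docstring in the source.) -/
theorem conj02_sans (E : EndStateSansQautAlb T Pc) : EndStateSansQautAlb T.conj02 Pc :=
  E.withTheta _
    (fun _ _ _ _ hi _ hω => hω.elim id fun h => absurd h.1 (by rcases hi with rfl | rfl <;> decide))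
    (fun _ _ _ _ _ _ hω => Or.inl hω)

/-- (Ported verbatim from the HodgeCMPerL package; no docstring in the source.) -/
theorem conj02_qautBinder (hQ : QautBinder T) : QautBinder T.conj02 :=
  qautBinder_withTheta _ (fun _ _ _ _ _ _ hω => Or.inl hω) hQ

/-- `(U, T.conj02)` REFUTES `hAlb` as soon as `(U, T) ⊨ ModelAxioms ∧ EndState`: `hAlb` (with M38 and the model
axioms) gives `Open_thetaSub` (`N12a_thetaSub_of_split`), refuted by toy2's `conj02_not_thetaSub''`. -/
theorem conj02_not_thetaAlbanese (M : U.ModelAxioms) (E : EndState T Pc) : ¬ T.conj02.Fact_thetaAlbanese :=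
  fun h => T.conj02_not_thetaSub'' M.pull_hodge E.h12b.1 E.h12b.2 (E.inputs M).thetaSub (E.inputs M).thetaWedge
    (N12a_thetaSub_of_split M T.conj02 E.hM38 h)

/-- **Separating model for `hAlb` at headline level.** -/
theorem separating_alb (M : U.ModelAxioms) (E : EndState T Pc) :
    U.ModelAxioms ∧ U.PerL ∧ EndStateSansQautAlb T.conj02 Pc ∧ QautBinder T.conj02 ∧
      ¬ T.conj02.Fact_thetaAlbanese :=
  ⟨M, E.perL M, conj02_sans (endState_iff_sans.mp E).1, conj02_qautBinder E.hQ, conj02_not_thetaAlbanese M E⟩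

end EndStateBinderSep

open EndStateShadow EndStateBinderSep in
/-- **If the end state has a model at all, then it has one (with PerL) in which every binder but `hQ` holds and
`hQ` fails** — the `(34)` Qaut bridge is neither derivable from nor necessary alongside the rest. -/
theorem exists_model_endState_sans_qaut
    (h : ∃ (U : Universe) (T : U.ThetaModel)
      (Pc : ∀ {L : CMField} {ι₁ : L →+* ℂ} (V : HermSpace3 L ι₁) (c : SeesawCtx L), C4a.PointedCore (T.core V c)),
      U.ModelAxioms ∧ EndState T Pc) :
    ∃ (U : Universe) (T : U.ThetaModel)
      (Pc : ∀ {L : CMField} {ι₁ : L →+* ℂ} (V : HermSpace3 L ι₁) (c : SeesawCtx L), C4a.PointedCore (T.core V c)),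
      U.ModelAxioms ∧ U.PerL ∧ EndStateSansQautAlb T Pc ∧ T.Fact_thetaAlbanese ∧ ¬ QautBinder T := by
  obtain ⟨U, T, Pc, M, E⟩ := h
  exact ⟨U, T.drop23, Pc, separating_qaut M E⟩

open EndStateShadow EndStateBinderSep in
/-- **… and one (with PerL) in which every binder but `hAlb` holds and `hAlb` fails.** -/
theorem exists_model_endState_sans_alb
    (h : ∃ (U : Universe) (T : U.ThetaModel)
      (Pc : ∀ {L : CMField} {ι₁ : L →+* ℂ} (V : HermSpace3 L ι₁) (c : SeesawCtx L), C4a.PointedCore (T.core V c)),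
      U.ModelAxioms ∧ EndState T Pc) :
    ∃ (U : Universe) (T : U.ThetaModel)
      (Pc : ∀ {L : CMField} {ι₁ : L →+* ℂ} (V : HermSpace3 L ι₁) (c : SeesawCtx L), C4a.PointedCore (T.core V c)),
      U.ModelAxioms ∧ U.PerL ∧ EndStateSansQautAlb T Pc ∧ QautBinder T ∧ ¬ T.Fact_thetaAlbanese := by
  obtain ⟨U, T, Pc, M, E⟩ := h
  exact ⟨U, T.conj02, Pc, separating_alb M E⟩

end PerL34

end HodgeCM

end
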